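import Mathlib
import HarnessLib
import Summits.HubbardSuperconductivity.HubbardSuperconductivity.Theses.KLProgramme
import Summits.HubbardSuperconductivity.HubbardSuperconductivity.Theorems.KLProgrammeKLRegimeVolumeLimitDefs
import Summits.HubbardSuperconductivity.HubbardSuperconductivity.Theorems.KLProgrammeKLRegimeTwoPointAssemblyRepr
import Summits.HubbardSuperconductivity.HubbardSuperconductivity.Theorems.KLProgrammeKLRegimeTwoPointAssemblyDiag
import Summits.HubbardSuperconductivity.HubbardSuperconductivity.Theorems.KLProgrammeKLRegimeTwoPointAssemblyFree
import Summits.HubbardSuperconductivity.HubbardSuperconductivity.Theorems.KLProgrammeKLRegimeTwoPointAssemblyInt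
import Summits.HubbardSuperconductivity.HubbardSuperconductivity.Theorems.KLProgrammeKLRegimeTwoPointAssemblyFrame
import Summits.HubbardSuperconductivity.HubbardSuperconductivity.Theorems.KLProgrammeKLRegimeTwoPointAssemblyStubAsmMatsubara
import Summits.HubbardSuperconductivity.HubbardSuperconductivity.Theorems.KLProgrammeKLRegimeTwoPointAssemblyStubAsmPartition
import Literature.Probability.LatticeModels.TorusCentredLift

/-!
# Child 4 `KLRegimeTwoPointAssemblyV7` (stmt-HubbardSuperconductivity-19666) = `TwoPointAssemblyP3 klPredsV7 FinalTwoLegVolLimit klWindowC`,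
# PROVED — for EVERY bundle `Pr` and window `W` (line `asm-repr`, lead hubbard-kl-r2d-p2; all stubs landed)
# (line `asm-repr`, lead hubbard-kl-r2d-p2), for EVERY predicate bundle `Pr` and window `W`

Child 4 reads only the volume-limit slot `VL = FinalTwoLegVolLimit` (p448970) and model identities; the tower `TowerP` is child 5's
input, not ours.  Composition at fixed `(β, U, μ, K)`: for large `L`,
`T_L − ½δ_L = lim_M bareRatio_{L,M}` (`stub_asm_matsubara`, LANDED = t2's all-`U` theorem); eventually in `M` the bare ratio is the
countertermed one (`stub_asm_frame`, LANDED) which is `twoPointReprCT` (`stub_asm_repr`, LANDED) `= reprFree + reprInt`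
(`stub_asm_diag`: conservation + the pair function of `C^K`); `reprFree_{L,M} → fM L → F` (`stub_asm_free`: Matsubara tadpole + torus
Riemann sums) and `reprInt` is CAUCHY in the iterated sense (`stub_asm_int`, from `FinalTwoLegVolLimit`: grid convergence at each
Matsubara integer + uniform bound `B` against `|ĝ_K|² ≤ ω⁻²`), so `lim_M reprInt_{L,M} = T_L − ½δ_L − fM L` exists and is Cauchy in
`L`, hence converges (`ℂ` complete).
-/

noncomputable section

namespace Summit.HubbardSuperconductivity.HubbardSuperconductivity.Theorems.TwoPointAssembly

set_option linter.dupNamespace false -- summit = problem name (single-conjunct summit), D-0017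

open Real Finset Filter Topology Literature.MathematicalPhysics.QuantumLattice Literature.Probability.LatticeModels
open GrassmannAlgebra
open Summit.HubbardSuperconductivity.HubbardSuperconductivity.Theorems.KLRegimeSplit
open Summit.HubbardSuperconductivity.HubbardSuperconductivity.Theorems.KLProgrammeLegKernels

/-! ## §1 Objects: `…TwoPointAssemblyLimitDefs` (`propCT`, `sitePhase`, `reprFree`, `reprInt`) -/

/-! ## §2 Stubs: ALL LANDED — `stub_asm_diag` (…Diag), `stub_asm_free` (…Free), `stub_asm_int` (…Int); with t2's
`stub_asm_matsubara`/`stub_asm_partition` and `stub_asm_frame`/`stub_asm_repr` of the rev-9 cut. -/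

/-! ## §3 Composition -/

/-- For `L` beyond the coordinate differences, `x̄ = ȳ` on the torus iff `x = y`. -/
theorem proj_eq_proj_iff_of_lt {x y : Site 2} {L : ℕ} (hL : ∀ j, |x j - y j| < L) :
    Torus.proj L x = Torus.proj L y ↔ x = y :=
  ⟨fun h => Torus.proj_injective_of_abs_sub_lt hL h, fun h => by rw [h]⟩

/-- The midpoint correction is eventually (in `L`) the infinite-volume one. -/
theorem halfDelta_eventually (σ σ' : Fin 2) (x y : Site 2) :
    ∀ᶠ L : ℕ in atTop, (if σ = σ' ∧ Torus.proj L x = Torus.proj L y then (1 / 2 : ℂ) else 0) = halfDelta σ σ' x y := by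
  have hb : ∃ B : ℕ, ∀ j, |x j - y j| < (B : ℤ) := by
    refine ⟨(∑ j, |x j - y j|).toNat + 1, fun j => ?_⟩
    have h1 : |x j - y j| ≤ ∑ i, |x i - y i| := Finset.single_le_sum (fun i _ => abs_nonneg (x i - y i)) (Finset.mem_univ j)
    have h2 : (∑ i, |x i - y i|) ≤ ((∑ i, |x i - y i|).toNat : ℤ) := Int.self_le_toNat _
    push_cast
    linarith
  obtain ⟨B, hB⟩ := hb
  filter_upwards [eventually_ge_atTop B] with L hL
  have hlt : ∀ j, |x j - y j| < (L : ℤ) := fun j => lt_of_lt_of_le (hB j) (by exact_mod_cast hL)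
  rw [halfDelta]
  exact if_congr (Iff.and Iff.rfl (proj_eq_proj_iff_of_lt hlt)) rfl rfl

/-- **Eventually in `M`, the bare ratio IS the representation** `reprFree + reprInt` (frame + repr + partition + diag). -/
theorem grassmannRatio_eventually_eq {L : ℕ} [NeZero L] (hL : 3 ≤ L) {β : ℝ} (hβ : 0 < β) (U μ : ℝ) (K : TrigPolyC4v)
    (σ σ' : Fin 2) (xe ye : TorusSite 2 L) :
    ∀ᶠ M : ℕ in atTop, grassmannRatio L M β U μ σ σ' xe ye = reprFree L M β μ K σ σ' xe ye + reprInt L M β U μ K σ σ' xe ye := by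
  filter_upwards [stub_asm_partition L hL β hβ μ U, eventually_ge_atTop 1] with M hZ hM
  haveI : NeZero M := ⟨by omega⟩
  obtain ⟨N, hN, hframe⟩ := stub_asm_frame L M β hβ μ U K
  have hden : effPartitionFn ℂ (hubbardCovarianceCT L M β μ 0 K) (hubbardInteractionCT L M β U K) =
      N * effPartitionFn ℂ (hubbardCovariance L M β μ 0) (hubbardInteraction L M β U) := by
    rw [effPartitionFn_eq_gaussExpect, effPartitionFn_eq_gaussExpect, ← one_mul (grassmannExp _), hframe 1, one_mul]
  have hZK : effPartitionFn ℂ (hubbardCovarianceCT L M β μ 0 K) (hubbardInteractionCT L M β U K) ≠ 0 := by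
    rw [hden]; exact mul_ne_zero hN hZ
  have hrepr := stub_asm_repr L M β U μ K σ σ' xe ye hZK
  rw [← stub_asm_diag L M β hβ U μ K σ σ' xe ye, grassmannRatio]
  rw [hframe (twoPointInsertion L M β σ σ' xe ye), hden] at hrepr
  rw [div_eq_iff hZ]
  apply mul_left_cancel₀ hN
  rw [hrepr]; ring

/-- **Child 4 (V7 cut) from the stubs**, for every bundle `Pr` and window `W`. -/
theorem twoPointAssemblyP3_of (Pr : Preds) (W : Set ℝ) : TwoPointAssemblyP3 Pr FinalTwoLegVolLimit W := by
  intro G P Q R _ _ _ _ c _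
  refine ⟨1, one_pos, ?_⟩
  intro μ _ U _ _ β hβmin _ Lstar Mstar hyp x y σ σ'
  obtain ⟨K, _, _, hVL⟩ := hyp
  have hβ : 0 < β := pos_of_klBetaMin_le hβmin
  obtain ⟨fM, F, hfM, hF⟩ := stub_asm_free β hβ μ K σ σ' x y
  have hint := stub_asm_int β hβ U μ K Mstar hVL σ σ' x y
  -- `u L = T_L − ½δ_L`, the `M`-limit of the bare ratio at `L ≥ 3`
  set u : ℕ → ℂ := fun L => hubbardThermalTwoPoint β U (μ + U / 2) L x y σ σ' -
    (if σ = σ' ∧ Torus.proj L x = Torus.proj L y then (1 / 2 : ℂ) else 0) with hu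
  -- `w L = u L − fM L`, the `M`-limit of the interacting part
  set w : ℕ → ℂ := fun L => u L - fM L with hw
  have hwlim : ∀ (L : ℕ) [NeZero L], 3 ≤ L →
      Tendsto (fun M : ℕ => reprInt L M β U μ K σ σ' (Torus.proj L x) (Torus.proj L y)) atTop (𝓝 (w L)) := by
    intro L _ hL
    have hmats := stub_asm_matsubara L hL β hβ μ U σ σ' x y
    have h1 : Tendsto (fun M : ℕ => grassmannRatio L M β U μ σ σ' (Torus.proj L x) (Torus.proj L y) -
        reprFree L M β μ K σ σ' (Torus.proj L x) (Torus.proj L y)) atTop (𝓝 (u L - fM L)) := hmats.sub (hfM L hL)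
    refine h1.congr' ?_
    filter_upwards [grassmannRatio_eventually_eq hL hβ U μ K σ σ' (Torus.proj L x) (Torus.proj L y)] with M hM
    rw [hM]; ring
  -- `w` is Cauchy
  have hwC : CauchySeq fun n : ℕ => w (n + 3) := by
    rw [Metric.cauchySeq_iff]
    intro ε hε
    obtain ⟨L₁, hL₁⟩ := hint (ε / 2) (half_pos hε)
    refine ⟨L₁, fun m hm n hn => ?_⟩
    haveI : NeZero (m + 3) := ⟨by omega⟩
    haveI : NeZero (n + 3) := ⟨by omega⟩
    obtain ⟨M₁, hM₁⟩ := hL₁ (m + 3) (n + 3) (by omega) (by omega)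
    have hev : ∀ᶠ M : ℕ in atTop, ‖reprInt (m + 3) M β U μ K σ σ' (Torus.proj (m + 3) x) (Torus.proj (m + 3) y) -
        reprInt (n + 3) M β U μ K σ σ' (Torus.proj (n + 3) x) (Torus.proj (n + 3) y)‖ ≤ ε / 2 := by
      filter_upwards [eventually_ge_atTop (max M₁ 1)] with M hM
      haveI : NeZero M := ⟨by have := le_of_max_le_right hM; omega⟩
      exact hM₁ M M (le_of_max_le_left hM) (le_of_max_le_left hM)
    have hlim := ((hwlim (m + 3) (by omega)).sub (hwlim (n + 3) (by omega))).norm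
    have hle : ‖w (m + 3) - w (n + 3)‖ ≤ ε / 2 := le_of_tendsto hlim hev
    rw [dist_eq_norm]; linarith
  obtain ⟨Wlim, hW⟩ := cauchySeq_tendsto_of_complete hwC
  have hW' : Tendsto w atTop (𝓝 Wlim) := by
    rw [← tendsto_add_atTop_iff_nat 3]; exact hW
  -- assemble: `T_L = u L + ½δ_L = w L + fM L + ½δ_L`
  obtain ⟨L₂, hL₂⟩ := (halfDelta_eventually σ σ' x y).exists_forall_of_atTop
  refine ⟨Wlim + F + halfDelta σ σ' x y, ?_⟩
  have hsum : Tendsto (fun L => w L + fM L + halfDelta σ σ' x y) atTop (𝓝 (Wlim + F + halfDelta σ σ' x y)) :=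
    (hW'.add hF).add tendsto_const_nhds
  refine hsum.congr' ?_
  filter_upwards [eventually_ge_atTop L₂] with L hL
  simp only [hw, hu, hL₂ L hL]
  ring

/-- **Child 4 BY NAME** (route decl of item stmt-HubbardSuperconductivity-19666,
`:= TwoPointAssemblyP3 klPredsV7 FinalTwoLegVolLimit klWindowC`). -/
theorem KLRegimeTwoPointAssemblyV7_of :
    Summit.HubbardSuperconductivity.HubbardSuperconductivity.Theses.KLProgramme.KLRegimeTwoPointAssemblyV7 :=
  twoPointAssemblyP3_of _ _

end Summit.HubbardSuperconductivity.HubbardSuperconductivity.Theorems.TwoPointAssembly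

end
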